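import Summits.CriticalPhenomena.Ising3DConformalLimit.Theses.ReflectionTwin
import Literature.Probability.LatticeModels.TwistedPlusExpect
import Literature.Probability.LatticeModels.HighDimPointwiseTriviality
import HarnessLib

/-!
# Disproof of `TwinTransparency` (stmt-CriticalPhenomena-16905) — findings of the standing crux disprover

Work file of `refuter-cdisprove-stmt-CriticalPhenomena-16905-0` (cycle 1, 2026-08-17), line `replica-mirror` picked.
Prose lives in docstrings; everything named `theorem` without `sorry` is kernel-checked (`lean check` rc 0).

FINDINGS INDEX
* §1 named closed terms (byte-identical with `Lines/replica_mirror.lean` §1) + `twinTransparency_iff := Iff.rfl`.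
* §2 THE DOUBLE EXISTENCE SHIELD (why no unconditional `¬ TwinTransparency` can exist in this generation):
  `twinTransparency_of_not_twinThreshold`, `twinTransparency_of_no_datum`, `not_twinTransparency_imp` —
  any refutation PROVES TwinThreshold (stmt-16906) AND the existence of a non-degenerate pointwise scaling
  limit of `criticalCorr 3` (the open existence clause of the conjunct, ICM2022 §8.4).
* §3 LOAD-BEARING ANALYSIS (hypothesis mutation, as theorems):
  - `TwinTransparencyWithoutOrderThreshold` := the crux with `IsSeamThreshold J` weakened to `0 ≤ J ∧ ¬ LRO J`
    (a disordered seam, not THE ordering threshold). FALSE for every admissible datum, witness `J = 0`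
    (the decoupled twin is opaque: every cross-plane correlator vanishes identically by a half-crystal spin flip,
    while the limit `S₂(p, A q) > 0`): `twinLat_cross_eq_zero_of_seam_zero`, `not_LRO_seam_zero`,
    `conclusion_false_at_seam_zero`, `twinTransparencyWithoutOrderThreshold_false_of_datum`. So the clauses
    `0 < J` / `∀ J' > J, LRO J'` are load-bearing: "no plane order" alone does not locate the transparent seam.
    LANDED (p168222, accepted 2026-08-17, def-free spelling with local notations) as the importable module
    `Summits.CriticalPhenomena.Ising3DConformalLimit.Theorems.TwinTransparency.Negative.WithoutOrderThreshold`
    (namespace `…Theorems.TwinTransparency.Negative`: `conclusion_false_at_seam_zero`, `not_LRO_seam_zero`,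
    `twinLat_cross_eq_zero_of_seam_zero`, `twinTransparencyWithoutOrderThreshold_false_of_datum`,
    `…_false_of_existsContinuousLimit`, `isSeamThreshold_unique`, `twinTransparency_iff`) — ideators / planners:
    import that module rather than this work file.
  - H1 (`ρ > 0`) and H3 (`S₂ > 0`) are MATCHING hypotheses, not load-bearing for truth (§3b, kernel-checked: the
    degenerate datum `ρ = exp(-1/δ)`, `S = (1,0,0,…)` has H1 ∧ H2 ∧ ¬H3 — `hasLimit_degenerate` — and SATISFIES the
    conclusion at every `J` with `A = id` — `conclusion_degenerate`).
  - CORRECTION to crux-attack r1 §6 ("drop the threshold ⇒ false via ρ → ∞ at an LRO coupling"): that argument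
    reads PLANE-LAYER sites, which the crux never reads (copy sites are strictly off `h = 0`); for off-plane points at
    macroscopic depth the ordered-plane correlator is `O(δ^{2Δ})` like the bulk one, and `¬`conclusion at an LRO
    coupling needs the extraordinary-profile lower bound `⟨σ_x⟩_{wall at R} ≳ R^{-Δ}` with the SAME `Δ` as the bulk
    decay — not in tree, not in print rigorously. Recorded as the near-miss `conclusion_false_of_LRO` (§5, sorry).
* §4 LINE `replica-mirror` (v2 skeleton, 7 stubs): no stub broken; S1–S3 true (S1 landed); S2's constant `12` has a
  factor-2 slack (`6 β_c` suffices); S4 true by `criticalCorr_wellDefined_holds` (free = plus at `β_c(3)`); S5/S6/S7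
  shielded exactly like the crux (datum existence; S6/S7 also by `∃ J, PlaneCritical J`); `PlaneCritical` excludes
  the `J = 0` witness through `0 < J` only — `slabChi 0 = ⊤` is FALSE too (decoupled plane), so either clause does it.
* §5 NEAR-MISSES (sorry, with the missing input named) and the numerics that support the crux
  (crux NOTES.md, kit j024992–j025040: `J* = 1.000 ± 0.003`, `κ = 1.00 ± 0.02`).

WHY IT RESISTS (one paragraph for the planner). TT is ONE concrete claim about 3D Ising at `β_c(3)` with no free
parameter (no degenerate instance to specialise), doubly shielded by open existence statements (§2), whose physical
content — the tuned θ-symmetric (111) seam flows to the trivial defect — is the standard defect-RG expectation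
(one relevant even plane operator `ε`, `y = 2 − Δ_ε ≈ 0.59`; next even ones `T_⊥⊥` at `y = −1`), is supported by the
ideator's Monte Carlo to 0.3 % in `J*` and 2 % in the cross amplitude, and whose "presupposes O(3)" risk is retired
(isotropy of every nice limit is a tree theorem since p129740). A kill needs either a non-trivial `ℤ₂ × θ`-symmetric
conformal interface of the 3D Ising class with exactly one relevant even direction (none in print: presearch §5),
or a first-order / `J* = 0` threshold (TwinThreshold's business, which would make TT vacuously TRUE, not false).
-/

noncomputable section

namespace Summit.CriticalPhenomena.Ising3DConformalLimit.Cruxes.TwinTransparency.Disproof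

open scoped BigOperators Topology Classical InnerProductSpace
open Filter Set Function
open Literature.Probability.LatticeModels

/-! ## §1 The crux objects as named closed terms (verbatim `Lines/replica_mirror.lean` §1) -/

/-- `ℝ³`. [folklore] -/
abbrev E : Type := EuclideanSpace ℝ (Fin 3)

/-- The Euclidean reflection `θ` in the twin plane `x₀+x₁+x₂ = 0`, as a closed term. [folklore] -/
def thetaC : E → E := (fun v : EuclideanSpace ℝ (Fin 3) => ((ℝ ∙ (EuclideanSpace.single 0 1 + EuclideanSpace.single 1 1 + EuclideanSpace.single 2 1 : EuclideanSpace ℝ (Fin 3)))ᗮ).reflection v)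

/-- Free-box twin correlator `⟨∏ᵢ σ_{zᵢ}⟩_{TW(J), box L}` (junk factor `0` off the box), closed term. [cite: FriedliVelenik2017, §3.1] -/
def twinBoxC : ℝ → ℕ → (k : ℕ) → (Fin k → Site 3) → ℝ := (fun (J : ℝ) (L : ℕ) (k : ℕ) (z : Fin k → Site 3) => PairIsing.gibbsAvg (fun a b : ↥(box 3 L) => if (((∑ i, |a.1 i - b.1 i| = 1) ∧ ¬ ((a.1 0 + a.1 1 + a.1 2 = 0 ∧ b.1 0 + b.1 1 + b.1 2 = 1) ∨ (a.1 0 + a.1 1 + a.1 2 = 1 ∧ b.1 0 + b.1 1 + b.1 2 = 0))) ∨ (((a.1 0 + a.1 1 + a.1 2 = 0 ∧ b.1 0 + b.1 1 + b.1 2 = 1) ∨ (a.1 0 + a.1 1 + a.1 2 = 1 ∧ b.1 0 + b.1 1 + b.1 2 = 0)) ∧ ∃ i : Fin 3, a.1 + b.1 = Pi.single i 1)) then (criticalBeta 3 / 2) * (if a.1 0 + a.1 1 + a.1 2 = 0 ∨ b.1 0 + b.1 1 + b.1 2 = 0 then J else 1) else 0) (fun s => ∏ i, if h : z i ∈ box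 3 L then spinAt (⟨z i, h⟩ : ↥(box 3 L)) s else 0))

/-- Sup-over-boxes twin correlator `twinLat` of the crux, closed term (verbatim TwinThreshold's `twinLatC`). [cite: FriedliVelenik2017, §3.1] -/
def twinLatC : ℝ → (k : ℕ) → (Fin k → Site 3) → ℝ := (fun (J : ℝ) (k : ℕ) (z : Fin k → Site 3) => ⨆ L : ℕ, PairIsing.gibbsAvg (fun a b : ↥(box 3 L) => if (((∑ i, |a.1 i - b.1 i| = 1) ∧ ¬ ((a.1 0 + a.1 1 + a.1 2 = 0 ∧ b.1 0 + b.1 1 + b.1 2 = 1) ∨ (a.1 0 + a.1 1 + a.1 2 = 1 ∧ b.1 0 + b.1 1 + b.1 2 = 0))) ∨ (((a.1 0 + a.1 1 + a.1 2 = 0 ∧ b.1 0 + b.1 1 + b.1 2 = 1) ∨ (a.1 0 + a.1 1 + a.1 2 = 1 ∧ b.1 0 + b.1 1 + b.1 2 = 0)) ∧ ∃ i : Fin 3, a.1 + b.1 = Pi.single i 1)) then (criticalBeta 3 / 2) * (if a.1 0 + a.1 1 + a.1 2 = 0 ∨ b.1 0 + b.1 1 + b.1 2 = 0 then J else 1)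 else 0) (fun s => ∏ i, if h : z i ∈ box 3 L then spinAt (⟨z i, h⟩ : ↥(box 3 L)) s else 0))

/-- Twin site of a continuum point at mesh `δ`, closed term. [folklore] -/
def siteC : ℝ → E → Site 3 := (fun (δ : ℝ) (v : EuclideanSpace ℝ (Fin 3)) => if v 0 + v 1 + v 2 ≤ 0 then latticeApprox δ v else -latticeApprox δ ((fun v : EuclideanSpace ℝ (Fin 3) => ((ℝ ∙ (EuclideanSpace.single 0 1 + EuclideanSpace.single 1 1 + EuclideanSpace.single 2 1 : EuclideanSpace ℝ (Fin 3)))ᗮ).reflection v) v))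

/-- Twin `k`-point function of a continuum configuration at mesh `δ`, closed term. [folklore] -/
def twinCorrC : ℝ → ℝ → (k : ℕ) → (Fin k → E) → ℝ := (fun (J δ : ℝ) (k : ℕ) (w : Fin k → EuclideanSpace ℝ (Fin 3)) => (fun (J : ℝ) (k : ℕ) (z : Fin k → Site 3) => ⨆ L : ℕ, PairIsing.gibbsAvg (fun a b : ↥(box 3 L) => if (((∑ i, |a.1 i - b.1 i| = 1) ∧ ¬ ((a.1 0 + a.1 1 + a.1 2 = 0 ∧ b.1 0 + b.1 1 + b.1 2 = 1) ∨ (a.1 0 + a.1 1 + a.1 2 = 1 ∧ b.1 0 + b.1 1 + b.1 2 = 0))) ∨ (((a.1 0 + a.1 1 + a.1 2 = 0 ∧ b.1 0 + b.1 1 + b.1 2 = 1) ∨ (a.1 0 + a.1 1 + a.1 2 = 1 ∧ b.1 0 + b.1 1 + b.1 2 = 0)) ∧ ∃ i : Fin 3, a.1 + b.1 = Pi.single i 1)) then (criticalBeta 3 / 2) * (if a.1 0 + a.1 1 + a.1 2 = 0 ∨ b.1 0 + b.1 1 + b.1 2 = 0 then J else 1) else 0) (fun s => ∏ i, if h : z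 i ∈ box 3 L then spinAt (⟨z i, h⟩ : ↥(box 3 L)) s else 0)) J k (fun i => (fun (δ : ℝ) (v : EuclideanSpace ℝ (Fin 3)) => if v 0 + v 1 + v 2 ≤ 0 then latticeApprox δ v else -latticeApprox δ ((fun v : EuclideanSpace ℝ (Fin 3) => ((ℝ ∙ (EuclideanSpace.single 0 1 + EuclideanSpace.single 1 1 + EuclideanSpace.single 2 1 : EuclideanSpace ℝ (Fin 3)))ᗮ).reflection v) v)) δ (w i)))

/-- Plane long-range order of the twin, closed term. [folklore] -/
def LROC : ℝ → Prop := (fun J : ℝ => ∃ m : ℝ, 0 < m ∧ ∀ c : Site 3, c 0 + c 1 + c 2 = 0 → m ≤ (fun (J : ℝ) (k : ℕ) (z : Fin k → Site 3) => ⨆ L : ℕ, PairIsing.gibbsAvg (fun a b : ↥(box 3 L) => if (((∑ i, |a.1 i - b.1 i| = 1) ∧ ¬ ((a.1 0 + a.1 1 + a.1 2 = 0 ∧ b.1 0 + b.1 1 + b.1 2 = 1) ∨ (a.1 0 + a.1 1 + a.1 2 = 1 ∧ b.1 0 + b.1 1 + b.1 2 = 0))) ∨ (((a.1 0 + a.1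 1 + a.1 2 = 0 ∧ b.1 0 + b.1 1 + b.1 2 = 1) ∨ (a.1 0 + a.1 1 + a.1 2 = 1 ∧ b.1 0 + b.1 1 + b.1 2 = 0)) ∧ ∃ i : Fin 3, a.1 + b.1 = Pi.single i 1)) then (criticalBeta 3 / 2) * (if a.1 0 + a.1 1 + a.1 2 = 0 ∨ b.1 0 + b.1 1 + b.1 2 = 0 then J else 1) else 0) (fun s => ∏ i, if h : z i ∈ box 3 L then spinAt (⟨z i, h⟩ : ↥(box 3 L)) s else 0)) J 2 ![0, c])

/-- Continuous strictly positive plane-ordering threshold, closed term. [folklore] -/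
def IsSeamThresholdC : ℝ → Prop := (fun J : ℝ => 0 < J ∧ ¬ (fun J : ℝ => ∃ m : ℝ, 0 < m ∧ ∀ c : Site 3, c 0 + c 1 + c 2 = 0 → m ≤ (fun (J : ℝ) (k : ℕ) (z : Fin k → Site 3) => ⨆ L : ℕ, PairIsing.gibbsAvg (fun a b : ↥(box 3 L) => if (((∑ i, |a.1 i - b.1 i| = 1) ∧ ¬ ((a.1 0 + a.1 1 + a.1 2 = 0 ∧ b.1 0 + b.1 1 + b.1 2 = 1) ∨ (a.1 0 + a.1 1 + a.1 2 = 1 ∧ b.1 0 + b.1 1 + b.1 2 = 0))) ∨ (((a.1 0 + a.1 1 + a.1 2 = 0 ∧ b.1 0 + b.1 1 + b.1 2 = 1) ∨ (a.1 0 + a.1 1 + a.1 2 = 1 ∧ b.1 0 + b.1 1 + b.1 2 = 0)) ∧ ∃ i : Fin 3, a.1 + b.1 = Pi.single i 1)) then (criticalBeta 3 / 2) * (if a.1 0 + a.1 1 + a.1 2 = 0 ∨ b.1 0 + b.1 1 + b.1 2 = 0 then J else 1) else 0) (fun s => ∏ i, if h : z i ∈ box 3 L then spinAt (⟨z i, h⟩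 : ↥(box 3 L)) s else 0)) J 2 ![0, c]) J ∧ ∀ J' : ℝ, J < J' → (fun J : ℝ => ∃ m : ℝ, 0 < m ∧ ∀ c : Site 3, c 0 + c 1 + c 2 = 0 → m ≤ (fun (J : ℝ) (k : ℕ) (z : Fin k → Site 3) => ⨆ L : ℕ, PairIsing.gibbsAvg (fun a b : ↥(box 3 L) => if (((∑ i, |a.1 i - b.1 i| = 1) ∧ ¬ ((a.1 0 + a.1 1 + a.1 2 = 0 ∧ b.1 0 + b.1 1 + b.1 2 = 1) ∨ (a.1 0 + a.1 1 + a.1 2 = 1 ∧ b.1 0 + b.1 1 + b.1 2 = 0))) ∨ (((a.1 0 + a.1 1 + a.1 2 = 0 ∧ b.1 0 + b.1 1 + b.1 2 = 1) ∨ (a.1 0 + a.1 1 + a.1 2 = 1 ∧ b.1 0 + b.1 1 + b.1 2 = 0)) ∧ ∃ i : Fin 3, a.1 + b.1 = Pi.single i 1)) then (criticalBeta 3 / 2) * (if a.1 0 + a.1 1 + a.1 2 = 0 ∨ b.1 0 + b.1 1 + b.1 2 = 0 then J else 1) else 0) (fun s => ∏ i, if h : z i ∈ box 3 L then spinAt (⟨z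 i, h⟩ : ↥(box 3 L)) s else 0)) J 2 ![0, c]) J')

/-- Three-layer slab susceptibility `χ_T(J) ∈ [0, ∞]` of the twin, closed term. [cite: DuminilCopinICM2022, §7.1] -/
def slabChiC : ℝ → ENNReal := (fun J : ℝ => ⨆ x : {y : Site 3 // (-1 ≤ y 0 + y 1 + y 2 ∧ y 0 + y 1 + y 2 ≤ 1)}, ∑' y : {y : Site 3 // (-1 ≤ y 0 + y 1 + y 2 ∧ y 0 + y 1 + y 2 ≤ 1)}, ENNReal.ofReal ((fun (J : ℝ) (k : ℕ) (z : Fin k → Site 3) => ⨆ L : ℕ, PairIsing.gibbsAvg (fun a b : ↥(box 3 L) => if (((∑ i, |a.1 i - b.1 i| = 1) ∧ ¬ ((a.1 0 + a.1 1 + a.1 2 = 0 ∧ b.1 0 + b.1 1 + b.1 2 = 1) ∨ (a.1 0 + a.1 1 + a.1 2 = 1 ∧ b.1 0 + b.1 1 + b.1 2 = 0))) ∨ (((a.1 0 + a.1 1 + a.1 2 = 0 ∧ b.1 0 + b.1 1 + b.1 2 = 1) ∨ (a.1 0 + a.1 1 + a.1 2 = 1 ∧ b.1 0 + b.1 1 +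 b.1 2 = 0)) ∧ ∃ i : Fin 3, a.1 + b.1 = Pi.single i 1)) then (criticalBeta 3 / 2) * (if a.1 0 + a.1 1 + a.1 2 = 0 ∨ b.1 0 + b.1 1 + b.1 2 = 0 then J else 1) else 0) (fun s => ∏ i, if h : z i ∈ box 3 L then spinAt (⟨z i, h⟩ : ↥(box 3 L)) s else 0)) J 2 ![x.1, y.1]))

/-- Plane-criticality of a seam coupling: `0 < J`, `χ_T(J) = ⊤`, no plane LRO. [cite: KrishnanMetlitski2023, §1] -/
def PlaneCriticalC : ℝ → Prop := (fun J : ℝ => 0 < J ∧ (fun J : ℝ => ⨆ x : {y : Site 3 // (-1 ≤ y 0 + y 1 + y 2 ∧ y 0 + y 1 + y 2 ≤ 1)}, ∑' y : {y : Site 3 // (-1 ≤ y 0 + y 1 + y 2 ∧ y 0 + y 1 + y 2 ≤ 1)}, ENNReal.ofReal ((fun (J : ℝ) (k : ℕ) (z : Fin k → Site 3) => ⨆ L : ℕ, PairIsing.gibbsAvg (fun a b : ↥(box 3 L) => if (((∑ i, |a.1 i - b.1 i| = 1) ∧ ¬ ((a.1 0 + a.1 1 + a.1 2 = 0 ∧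 b.1 0 + b.1 1 + b.1 2 = 1) ∨ (a.1 0 + a.1 1 + a.1 2 = 1 ∧ b.1 0 + b.1 1 + b.1 2 = 0))) ∨ (((a.1 0 + a.1 1 + a.1 2 = 0 ∧ b.1 0 + b.1 1 + b.1 2 = 1) ∨ (a.1 0 + a.1 1 + a.1 2 = 1 ∧ b.1 0 + b.1 1 + b.1 2 = 0)) ∧ ∃ i : Fin 3, a.1 + b.1 = Pi.single i 1)) then (criticalBeta 3 / 2) * (if a.1 0 + a.1 1 + a.1 2 = 0 ∨ b.1 0 + b.1 1 + b.1 2 = 0 then J else 1) else 0) (fun s => ∏ i, if h : z i ∈ box 3 L then spinAt (⟨z i, h⟩ : ↥(box 3 L)) s else 0)) J 2 ![x.1, y.1])) J = ⊤ ∧ ¬ (fun J : ℝ => ∃ m : ℝ, 0 < m ∧ ∀ c : Site 3, c 0 + c 1 + c 2 = 0 → m ≤ (fun (J : ℝ) (k : ℕ) (z : Fin k → Site 3) => ⨆ L : ℕ, PairIsing.gibbsAvg (fun a b : ↥(box 3 L) => if (((∑ i, |a.1 i - b.1 i| = 1) ∧ ¬ ((a.1 0 + a.1 1 + a.1 2 =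 0 ∧ b.1 0 + b.1 1 + b.1 2 = 1) ∨ (a.1 0 + a.1 1 + a.1 2 = 1 ∧ b.1 0 + b.1 1 + b.1 2 = 0))) ∨ (((a.1 0 + a.1 1 + a.1 2 = 0 ∧ b.1 0 + b.1 1 + b.1 2 = 1) ∨ (a.1 0 + a.1 1 + a.1 2 = 1 ∧ b.1 0 + b.1 1 + b.1 2 = 0)) ∧ ∃ i : Fin 3, a.1 + b.1 = Pi.single i 1)) then (criticalBeta 3 / 2) * (if a.1 0 + a.1 1 + a.1 2 = 0 ∨ b.1 0 + b.1 1 + b.1 2 = 0 then J else 1) else 0) (fun s => ∏ i, if h : z i ∈ box 3 L then spinAt (⟨z i, h⟩ : ↥(box 3 L)) s else 0)) J 2 ![0, c]) J)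

/-- **Syntactic bridge**: the crux over the named closed terms, by `Iff.rfl`. [folklore] -/
theorem twinTransparency_iff :
    Summit.CriticalPhenomena.Ising3DConformalLimit.Theses.ReflectionTwin.TwinTransparency ↔
      ∀ (ρ : ℝ → ℝ) (S : CorrFamily 3), (∀ δ ∈ Set.Ioc (0:ℝ) 1, 0 < ρ δ) →
        HasPointwiseScalingLimit (criticalCorr 3) ρ S → IsNondegenerateTwoPoint S →
        ∀ J : ℝ, IsSeamThresholdC J →
          ∃ A : E →ₗ[ℝ] E, (∀ v, v 0 + v 1 + v 2 = 0 → A v = v) ∧ (∀ v, 0 < v 0 + v 1 + v 2 → 0 < A v 0 + A v 1 + A v 2) ∧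
            ∀ k : ℕ, TendstoLocallyUniformlyOn (fun δ w => ρ δ ^ k * twinCorrC J δ k w)
              (fun w => S k (fun i => if w i 0 + w i 1 + w i 2 ≤ 0 then w i else A (w i))) (𝓝[>] (0:ℝ))
              (NonCoincident 3 k ∩ {w | ∀ i, w i 0 + w i 1 + w i 2 ≠ 0}) :=
  Iff.rfl

/-- `twinLatC J k z = ⨆ L, twinBoxC J L k z`. [folklore] -/
theorem twinLatC_eq_iSup (J : ℝ) (k : ℕ) (z : Fin k → Site 3) : twinLatC J k z = ⨆ L, twinBoxC J L k z := rfl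

/-- `PlaneCriticalC J ↔ 0 < J ∧ slabChiC J = ⊤ ∧ ¬ LROC J`. [folklore] -/
theorem planeCriticalC_iff (J : ℝ) : PlaneCriticalC J ↔ 0 < J ∧ slabChiC J = ⊤ ∧ ¬ LROC J := Iff.rfl

/-- `IsSeamThresholdC J ↔ 0 < J ∧ ¬ LROC J ∧ ∀ J' > J, LROC J'`. [folklore] -/
theorem isSeamThresholdC_iff (J : ℝ) : IsSeamThresholdC J ↔ 0 < J ∧ ¬ LROC J ∧ ∀ J' : ℝ, J < J' → LROC J' := Iff.rfl


/-! ## §2 The double existence shield (vacuity by design, kernel-checked; cf. crux-attack r1 `S1.lean`) -/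

/-- TT is implied by the FAILURE of its sibling crux TwinThreshold: with no continuous positive threshold the
quantifier `∀ J, IsSeamThreshold J → …` is empty. Hence `¬TT → TwinThreshold`. [folklore] -/
theorem twinTransparency_of_not_twinThreshold
    (h : ¬ Summit.CriticalPhenomena.Ising3DConformalLimit.Theses.ReflectionTwin.TwinThreshold) :
    Summit.CriticalPhenomena.Ising3DConformalLimit.Theses.ReflectionTwin.TwinTransparency := by
  rw [twinTransparency_iff]
  intro ρ S _ _ _ J hJ
  exact absurd ⟨J, hJ⟩ h

/-- TT is implied by the NON-EXISTENCE of an admissible datum `(ρ, S)` (`ρ > 0` on `(0,1]`, pointwise scaling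
limit of `criticalCorr 3`, `S₂ > 0`): the outer quantifier is then empty. [folklore] -/
theorem twinTransparency_of_no_datum
    (h : ¬ ∃ (ρ : ℝ → ℝ) (S : CorrFamily 3), (∀ δ ∈ Set.Ioc (0:ℝ) 1, 0 < ρ δ) ∧
      HasPointwiseScalingLimit (criticalCorr 3) ρ S ∧ IsNondegenerateTwoPoint S) :
    Summit.CriticalPhenomena.Ising3DConformalLimit.Theses.ReflectionTwin.TwinTransparency := by
  rw [twinTransparency_iff]
  intro ρ S hρ hlim hnd J _
  exact absurd ⟨ρ, S, hρ, hlim, hnd⟩ h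

/-- **Any refutation of TT proves two open existence statements**: the continuous positive seam threshold
(TwinThreshold, stmt-16906) and the existence of a non-degenerate pointwise scaling limit of the critical
correlators on `ℤ³` (the existence clause of `ExistsContinuousLimit`, stmt-4582). [folklore] -/
theorem not_twinTransparency_imp
    (h : ¬ Summit.CriticalPhenomena.Ising3DConformalLimit.Theses.ReflectionTwin.TwinTransparency) :
    Summit.CriticalPhenomena.Ising3DConformalLimit.Theses.ReflectionTwin.TwinThreshold ∧
      ∃ (ρ : ℝ → ℝ) (S : CorrFamily 3), (∀ δ ∈ Set.Ioc (0:ℝ) 1, 0 < ρ δ) ∧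
        HasPointwiseScalingLimit (criticalCorr 3) ρ S ∧ IsNondegenerateTwoPoint S :=
  ⟨Classical.by_contradiction fun h' => h (twinTransparency_of_not_twinThreshold h'),
   Classical.by_contradiction fun h' => h (twinTransparency_of_no_datum h')⟩

/-- At most one seam coupling is a threshold (no monotonicity needed). [folklore] -/
theorem isSeamThresholdC_unique {J₁ J₂ : ℝ} (h₁ : IsSeamThresholdC J₁) (h₂ : IsSeamThresholdC J₂) :
    J₁ = J₂ := by
  rw [isSeamThresholdC_iff] at h₁ h₂
  rcases lt_trichotomy J₁ J₂ with h | h | h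
  · exact absurd (h₁.2.2 J₂ h) h₂.2.1
  · exact h
  · exact absurd (h₂.2.2 J₁ h) h₁.2.1

/-! ## §3 Load-bearing analysis

### §3a The ordering-threshold clause is load-bearing: the decoupled twin (`J = 0`) is opaque -/

/-- Partial spin flip on the sites satisfying `p`. [folklore] -/
def flipOn {ι : Type*} (p : ι → Prop) [DecidablePred p] (s : SpinConfig ι) : SpinConfig ι :=
  fun a => if p a then -s a else s a

/-- A partial flip is an involution. [folklore] -/
theorem flipOn_flipOn {ι : Type*} (p : ι → Prop) [DecidablePred p] (s : SpinConfig ι) :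
    flipOn p (flipOn p s) = s := by
  funext a
  by_cases h : p a <;> simp [flipOn, h]

/-- The real spin after a partial flip. [folklore] -/
theorem spinAt_flipOn {ι : Type*} (p : ι → Prop) [DecidablePred p] (s : SpinConfig ι) (a : ι) :
    spinAt a (flipOn p s) = if p a then -spinAt a s else spinAt a s := by
  by_cases h : p a <;> simp [flipOn, spinAt, h, Units.val_neg]

/-- A partial flip across a CUT of the coupling graph (no coupling joins a flipped to an unflipped site)
preserves the Boltzmann weight. [folklore] -/
theorem gibbsWeight_flipOn {ι : Type*} [Fintype ι] [DecidableEq ι] (p : ι → Prop) [DecidablePred p]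
    (c : ι → ι → ℝ) (hc : ∀ a b, p a → ¬ p b → c a b = 0 ∧ c b a = 0) (s : SpinConfig ι) :
    PairIsing.gibbsWeight c (flipOn p s) = PairIsing.gibbsWeight c s := by
  unfold PairIsing.gibbsWeight
  congr 1
  refine Finset.sum_congr rfl fun a _ => Finset.sum_congr rfl fun b _ => ?_
  rw [spinAt_flipOn, spinAt_flipOn]
  by_cases ha : p a <;> by_cases hb : p b
  · simp [ha, hb]
  · simp [(hc a b ha hb).1]
  · simp [(hc b a hb ha).2]
  · simp [ha, hb]

/-- An observable ODD under a weight-preserving partial flip has Gibbs average zero. [folklore] -/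
theorem gibbsAvg_eq_zero_of_flipOn {ι : Type*} [Fintype ι] [DecidableEq ι] (p : ι → Prop) [DecidablePred p]
    (c : ι → ι → ℝ) (hc : ∀ a b, p a → ¬ p b → c a b = 0 ∧ c b a = 0) (f : SpinConfig ι → ℝ)
    (hf : ∀ s, f (flipOn p s) = -f s) : PairIsing.gibbsAvg c f = 0 := by
  rw [PairIsing.gibbsAvg_def]
  have hnum : ∑ s, f s * PairIsing.gibbsWeight c s = 0 := by
    set e : SpinConfig ι ≃ SpinConfig ι :=
      Function.Involutive.toPerm (flipOn p) (flipOn_flipOn p) with he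
    have h1 : ∑ s, f s * PairIsing.gibbsWeight c s = ∑ s, f (e s) * PairIsing.gibbsWeight c (e s) :=
      (Equiv.sum_comp e (fun s => f s * PairIsing.gibbsWeight c s)).symm
    have h2 : ∑ s, f (e s) * PairIsing.gibbsWeight c (e s) = -∑ s, f s * PairIsing.gibbsWeight c s := by
      rw [← Finset.sum_neg_distrib]
      refine Finset.sum_congr rfl fun s _ => ?_
      show f (flipOn p s) * PairIsing.gibbsWeight c (flipOn p s) = -(f s * PairIsing.gibbsWeight c s)
      rw [hf, gibbsWeight_flipOn p c hc, neg_mul]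
    linarith
  rw [hnum, zero_div]

/-- Height `h z = z₀ + z₁ + z₂` of adjacent twin sites differs by at most one. [folklore] -/
theorem abs_height_sub_le_of_adj {a b : Site 3}
    (h : ((∑ i, |a i - b i| = 1) ∧ ¬ ((a 0 + a 1 + a 2 = 0 ∧ b 0 + b 1 + b 2 = 1) ∨ (a 0 + a 1 + a 2 = 1 ∧ b 0 + b 1 + b 2 = 0))) ∨ (((a 0 + a 1 + a 2 = 0 ∧ b 0 + b 1 + b 2 = 1) ∨ (a 0 + a 1 + a 2 = 1 ∧ b 0 + b 1 + b 2 = 0)) ∧ ∃ i : Fin 3, a + b = Pi.single i 1)) :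
    |(a 0 + a 1 + a 2) - (b 0 + b 1 + b 2)| ≤ 1 := by
  rcases h with ⟨h1, -⟩ | ⟨h2, -⟩
  · have hs : (a 0 + a 1 + a 2) - (b 0 + b 1 + b 2) = ∑ i, (a i - b i) := by
      simp only [Fin.sum_univ_three]; ring
    rw [hs, ← h1]
    exact Finset.abs_sum_le_sum_abs _ _
  · rcases h2 with ⟨ha, hb⟩ | ⟨ha, hb⟩ <;> rw [ha, hb] <;> norm_num

/-- **The decoupled twin is opaque.** At seam coupling `J = 0` every free-box twin correlator `⟨σ_x σ_y⟩` with
`h x ≤ 0 < h y` vanishes identically: the couplings of `TW(0)` vanish on every bond touching the plane layer, so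
flipping all spins strictly above the plane is a symmetry under which `σ_x σ_y` is odd. [folklore] -/
theorem twinBox_cross_eq_zero_of_seam_zero (L : ℕ) (z : Fin 2 → Site 3)
    (h0 : z 0 0 + z 0 1 + z 0 2 ≤ 0) (h1 : 1 ≤ z 1 0 + z 1 1 + z 1 2) :
    twinBoxC 0 L 2 z = 0 := by
  unfold twinBoxC
  refine gibbsAvg_eq_zero_of_flipOn (fun a : ↥(box 3 L) => 1 ≤ a.1 0 + a.1 1 + a.1 2) _ ?_ _ ?_
  · intro a b ha hb
    constructor
    · split_ifs with hadj hpl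
      · simp
      · exfalso
        have := abs_height_sub_le_of_adj hadj
        rw [abs_le] at this
        push Not at hpl
        omega
      · rfl
    · split_ifs with hadj hpl
      · simp
      · exfalso
        have := abs_height_sub_le_of_adj hadj
        rw [abs_le] at this
        push Not at hpl
        omega
      · rfl
  · intro s
    simp only [Fin.prod_univ_two]
    have hz0 : ¬ (1 ≤ z 0 0 + z 0 1 + z 0 2) := by omega
    by_cases hm0 : z 0 ∈ box 3 L <;> by_cases hm1 : z 1 ∈ box 3 L <;>
      simp [hm0, hm1, spinAt_flipOn, hz0, h1]

/-- Hence the sup over boxes vanishes too: `twinLat 0 2 (x, y) = 0` for `h x ≤ 0 < h y`. [folklore] -/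
theorem twinLat_cross_eq_zero_of_seam_zero (z : Fin 2 → Site 3)
    (h0 : z 0 0 + z 0 1 + z 0 2 ≤ 0) (h1 : 1 ≤ z 1 0 + z 1 1 + z 1 2) :
    twinLatC 0 2 z = 0 := by
  rw [twinLatC_eq_iSup]
  have : (fun L => twinBoxC 0 L 2 z) = fun _ => 0 := funext fun L => twinBox_cross_eq_zero_of_seam_zero L z h0 h1
  rw [this, ciSup_const]

/-- At `J = 0` the plane spins are isolated, so the plane two-point function `⟨σ_0 σ_c⟩` vanishes for every plane
site `c ≠ 0` (flip the single spin at `c`). [folklore] -/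
theorem twinBox_plane_eq_zero_of_seam_zero (L : ℕ) (c : Site 3) (hc : c 0 + c 1 + c 2 = 0) (hc0 : c ≠ 0) :
    twinBoxC 0 L 2 ![0, c] = 0 := by
  unfold twinBoxC
  refine gibbsAvg_eq_zero_of_flipOn (fun a : ↥(box 3 L) => a.1 = c) _ ?_ _ ?_
  · intro a b ha _
    have hpa : a.1 0 + a.1 1 + a.1 2 = 0 := by rw [ha]; exact hc
    constructor
    · split_ifs <;> simp_all
    · split_ifs <;> simp_all
  · intro s
    simp only [Fin.prod_univ_two, Matrix.cons_val_zero, Matrix.cons_val_one]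
    by_cases hm0 : (0 : Site 3) ∈ box 3 L <;> by_cases hm1 : c ∈ box 3 L <;>
      simp [hm0, hm1, spinAt_flipOn, hc0.symm]

/-- **No plane long-range order in the decoupled twin** (`¬ LRO 0`). [folklore] -/
theorem not_LRO_seam_zero : ¬ LROC 0 := by
  rintro ⟨m, hm, h⟩
  have hc : (![1, -1, 0] : Site 3) 0 + (![1, -1, 0] : Site 3) 1 + (![1, -1, 0] : Site 3) 2 = 0 := by decide
  have hc0 : (![1, -1, 0] : Site 3) ≠ 0 := by
    intro h; have := congrFun h 0; simp at this
  have hle := h ![1, -1, 0] hc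
  have hzero : twinLatC 0 2 ![0, ![1, -1, 0]] = 0 := by
    rw [twinLatC_eq_iSup]
    have : (fun L => twinBoxC 0 L 2 ![0, ![1, -1, 0]]) = fun _ => 0 :=
      funext fun L => twinBox_plane_eq_zero_of_seam_zero L _ hc hc0
    rw [this, ciSup_const]
  change m ≤ twinLatC 0 2 ![0, ![1, -1, 0]] at hle
  linarith


/-- A `Fin 2`-indexed family is injective iff its two values differ. [folklore] -/
theorem injective_fin_two {α : Type*} {f : Fin 2 → α} (h : f 0 ≠ f 1) : Function.Injective f := by
  intro i j hij
  fin_cases i <;> fin_cases j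
  · rfl
  · exact absurd hij h
  · exact absurd hij.symm h
  · rfl

/-- The normal vector `n = e₀ + e₁ + e₂` of the twin plane. [folklore] -/
def nrmC : E := EuclideanSpace.single 0 1 + EuclideanSpace.single 1 1 + EuclideanSpace.single 2 1

/-- Coordinates of `n`. [folklore] -/
theorem nrmC_apply (i : Fin 3) : nrmC i = 1 := by
  fin_cases i <;> simp [nrmC]

/-- Coordinates of `-n`. [folklore] -/
theorem neg_nrmC_apply (i : Fin 3) : (-nrmC) i = -1 := by
  rw [show (-nrmC) i = -(nrmC i) from rfl, nrmC_apply]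

/-- `θ n = -n` (Mathlib `Submodule.reflection_orthogonalComplement_singleton_eq_neg`). [folklore] -/
theorem thetaC_nrmC : thetaC nrmC = -nrmC :=
  Submodule.reflection_orthogonalComplement_singleton_eq_neg nrmC

/-- The copy-1 site of `-n` at mesh `δ > 0` lies strictly below the plane layer. [folklore] -/
theorem height_siteC_neg_nrmC {δ : ℝ} (hδ : 0 < δ) :
    (siteC δ (-nrmC)) 0 + (siteC δ (-nrmC)) 1 + (siteC δ (-nrmC)) 2 ≤ 0 := by
  have hle : (-nrmC) 0 + (-nrmC) 1 + (-nrmC) 2 ≤ 0 := by simp only [neg_nrmC_apply]; norm_num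
  have hs : siteC δ (-nrmC) = latticeApprox δ (-nrmC) := if_pos hle
  have hfl : ⌊(-1 : ℝ) / δ⌋ ≤ 0 := Int.floor_nonpos (div_nonpos_of_nonpos_of_nonneg (by norm_num) hδ.le)
  rw [hs]
  simp only [latticeApprox_apply, neg_nrmC_apply]
  omega

/-- The copy-2 site of `+n` at mesh `δ > 0` lies strictly above the plane layer. [folklore] -/
theorem height_siteC_nrmC {δ : ℝ} (hδ : 0 < δ) :
    1 ≤ (siteC δ nrmC) 0 + (siteC δ nrmC) 1 + (siteC δ nrmC) 2 := by
  have hgt : ¬ (nrmC 0 + nrmC 1 + nrmC 2 ≤ 0) := by simp only [nrmC_apply]; norm_num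
  have hs : siteC δ nrmC = -latticeApprox δ (thetaC nrmC) := if_neg hgt
  have hfl : ⌊(-1 : ℝ) / δ⌋ ≤ -1 := by
    rw [Int.floor_le_iff]; push_cast
    have : (-1 : ℝ) / δ < 0 := div_neg_of_neg_of_pos (by norm_num) hδ
    linarith
  rw [hs, thetaC_nrmC]
  simp only [Pi.neg_apply, latticeApprox_apply, neg_nrmC_apply]
  omega

/-- **The conclusion of TT fails at seam coupling `J = 0` for EVERY datum with `S₂ > 0`** (no scaling-limit
hypothesis and no positivity of `ρ` needed): the cross-plane pair `(-n, +n)` reads the lattice pair `(z, -z)` with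
`h z ≤ -3`, whose decoupled-twin correlator is identically `0` (`twinLat_cross_eq_zero_of_seam_zero`), while the
asserted limit `S₂(-n, A n)` is positive (`A n` lies above the plane, `-n` below, so the pair is non-coincident).
[folklore] -/
theorem conclusion_false_at_seam_zero (ρ : ℝ → ℝ) (S : CorrFamily 3) (hnd : IsNondegenerateTwoPoint S) :
    ¬ ∃ A : E →ₗ[ℝ] E, (∀ v, v 0 + v 1 + v 2 = 0 → A v = v) ∧ (∀ v, 0 < v 0 + v 1 + v 2 → 0 < A v 0 + A v 1 + A v 2) ∧
        ∀ k : ℕ, TendstoLocallyUniformlyOn (fun δ w => ρ δ ^ k * twinCorrC 0 δ k w)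
          (fun w => S k (fun i => if w i 0 + w i 1 + w i 2 ≤ 0 then w i else A (w i))) (𝓝[>] (0:ℝ))
          (NonCoincident 3 k ∩ {w | ∀ i, w i 0 + w i 1 + w i 2 ≠ 0}) := by
  rintro ⟨A, -, hAup, hconv⟩
  have hsum_n : nrmC 0 + nrmC 1 + nrmC 2 = 3 := by simp only [nrmC_apply]; norm_num
  have hsum_neg : (-nrmC) 0 + (-nrmC) 1 + (-nrmC) 2 = -3 := by simp only [neg_nrmC_apply]; norm_num
  have hne : (-nrmC : E) ≠ nrmC := by
    intro h
    have := congrArg (fun v : E => v 0) h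
    simp only [neg_nrmC_apply, nrmC_apply] at this
    norm_num at this
  set w : Fin 2 → E := ![-nrmC, nrmC] with hw
  have hw0 : w 0 = -nrmC := rfl
  have hw1 : w 1 = nrmC := rfl
  have hmem : w ∈ NonCoincident 3 2 ∩ {w | ∀ i, w i 0 + w i 1 + w i 2 ≠ 0} := by
    refine ⟨?_, ?_⟩
    · rw [mem_nonCoincident]
      exact injective_fin_two (by rw [hw0, hw1]; exact hne)
    · intro i
      fin_cases i
      · show w 0 0 + w 0 1 + w 0 2 ≠ 0
        rw [hw0, hsum_neg]; norm_num
      · show w 1 0 + w 1 1 + w 1 2 ≠ 0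
        rw [hw1, hsum_n]; norm_num
  -- the twin correlator at `w` vanishes for every mesh `δ > 0`
  have hzero : ∀ δ : ℝ, 0 < δ → twinCorrC 0 δ 2 w = 0 := by
    intro δ hδ
    show twinLatC 0 2 (fun i => siteC δ (w i)) = 0
    refine twinLat_cross_eq_zero_of_seam_zero _ ?_ ?_
    · show (siteC δ (w 0)) 0 + (siteC δ (w 0)) 1 + (siteC δ (w 0)) 2 ≤ 0
      rw [hw0]; exact height_siteC_neg_nrmC hδ
    · show 1 ≤ (siteC δ (w 1)) 0 + (siteC δ (w 1)) 1 + (siteC δ (w 1)) 2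
      rw [hw1]; exact height_siteC_nrmC hδ
  -- hence the asserted limit value is `0`
  have hlim := (hconv 2).tendsto_at hmem
  have hlim0 : Tendsto (fun _ : ℝ => (0:ℝ)) (𝓝[>] (0:ℝ))
      (𝓝 (S 2 (fun i => if w i 0 + w i 1 + w i 2 ≤ 0 then w i else A (w i)))) := by
    refine hlim.congr' (eventually_nhdsWithin_of_forall fun δ hδ => ?_)
    show ρ δ ^ 2 * twinCorrC 0 δ 2 w = 0
    rw [hzero δ hδ, mul_zero]
  have hval : S 2 (fun i => if w i 0 + w i 1 + w i 2 ≤ 0 then w i else A (w i)) = 0 :=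
    (tendsto_const_nhds_iff.mp hlim0).symm
  -- but the read configuration `(-n, A n)` is non-coincident, so `S₂ > 0` there
  have hcfg0 : (if w 0 0 + w 0 1 + w 0 2 ≤ 0 then w 0 else A (w 0)) = -nrmC := by
    rw [hw0, if_pos (by rw [hsum_neg]; norm_num)]
  have hcfg1 : (if w 1 0 + w 1 1 + w 1 2 ≤ 0 then w 1 else A (w 1)) = A nrmC := by
    rw [hw1, if_neg (by rw [hsum_n]; norm_num)]
  have hAn : 0 < A nrmC 0 + A nrmC 1 + A nrmC 2 := hAup nrmC (by rw [hsum_n]; norm_num)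
  have hne' : (-nrmC : E) ≠ A nrmC := by
    intro h
    rw [← h, hsum_neg] at hAn
    norm_num at hAn
  have hinj : (fun i => if w i 0 + w i 1 + w i 2 ≤ 0 then w i else A (w i)) ∈ NonCoincident 3 2 := by
    rw [mem_nonCoincident]
    exact injective_fin_two (by rw [hcfg0, hcfg1]; exact hne')
  exact absurd hval (hnd _ hinj).ne'

/-- **TT with the ordering-threshold clause weakened to "a disordered seam"**: `IsSeamThreshold J`
(`0 < J ∧ ¬LRO J ∧ ∀ J' > J, LRO J'`) replaced by `0 ≤ J ∧ ¬ LRO J`. Everything else verbatim. [folklore] -/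
def TwinTransparencyWithoutOrderThreshold : Prop :=
  ∀ (ρ : ℝ → ℝ) (S : CorrFamily 3), (∀ δ ∈ Set.Ioc (0:ℝ) 1, 0 < ρ δ) →
    HasPointwiseScalingLimit (criticalCorr 3) ρ S → IsNondegenerateTwoPoint S →
    ∀ J : ℝ, (0 ≤ J ∧ ¬ LROC J) →
      ∃ A : E →ₗ[ℝ] E, (∀ v, v 0 + v 1 + v 2 = 0 → A v = v) ∧ (∀ v, 0 < v 0 + v 1 + v 2 → 0 < A v 0 + A v 1 + A v 2) ∧
        ∀ k : ℕ, TendstoLocallyUniformlyOn (fun δ w => ρ δ ^ k * twinCorrC J δ k w)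
          (fun w => S k (fun i => if w i 0 + w i 1 + w i 2 ≤ 0 then w i else A (w i))) (𝓝[>] (0:ℝ))
          (NonCoincident 3 k ∩ {w | ∀ i, w i 0 + w i 1 + w i 2 ≠ 0})

/-- **`_false_without_` lemma: the ordering threshold is load-bearing.** For every admissible datum the weakened
crux fails at the disordered coupling `J = 0`; in particular it is false as soon as ONE admissible datum exists
(e.g. under `ExistsContinuousLimit`, stmt-4582). Any proof of TT must use `0 < J` or `∀ J' > J, LRO J'` — i.e. that
`J` is THE ordering threshold, not merely a coupling without plane order. [folklore] -/
theorem twinTransparencyWithoutOrderThreshold_false_of_datum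
    (hex : ∃ (ρ : ℝ → ℝ) (S : CorrFamily 3), (∀ δ ∈ Set.Ioc (0:ℝ) 1, 0 < ρ δ) ∧
      HasPointwiseScalingLimit (criticalCorr 3) ρ S ∧ IsNondegenerateTwoPoint S) :
    ¬ TwinTransparencyWithoutOrderThreshold := by
  obtain ⟨ρ, S, hρ, hlim, hnd⟩ := hex
  intro h
  exact conclusion_false_at_seam_zero ρ S hnd (h ρ S hρ hlim hnd 0 ⟨le_rfl, not_LRO_seam_zero⟩)

/-- The same packaged against the route's existence crux: `ExistsContinuousLimit → ¬ (weakened TT)`. [folklore] -/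
theorem twinTransparencyWithoutOrderThreshold_false_of_existsContinuousLimit
    (hE : Summit.CriticalPhenomena.Ising3DConformalLimit.Theses.ReflectionTwin.ExistsContinuousLimit) :
    ¬ TwinTransparencyWithoutOrderThreshold := by
  obtain ⟨ρ, Δ, S, hρ, -, hlim, -, -, hnd, -, -⟩ := hE
  exact twinTransparencyWithoutOrderThreshold_false_of_datum ⟨ρ, S, hρ, hlim, hnd⟩


/-! ### §3b The matching hypotheses H1 (`ρ > 0`) and H3 (`S₂ > 0`) are NOT load-bearing for truth

The degenerate datum `ρ_deg δ = exp(-1/δ)` (positive: H1 holds), `S_deg = (1, 0, 0, …)` IS a pointwise scaling limit of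
`criticalCorr 3` (H2 holds, `hasLimit_degenerate`) violating only H3, and it SATISFIES the conclusion of TT at every
seam coupling with `A = id` (`conclusion_degenerate`): the twin correlators are bounded by `1` (`abs_twinLatC_le_one`)
and `ρ_deg^k → 0` for `k ≥ 1`, while `twinLat J 0 = 1` (`twinLatC_zero`). So dropping H3 (or H1: `ρ ≡ 0` behaves the
same way) adds no cheaply refutable instance; the only other degenerate data are `ρ = o(ρ₀)` rescalings of a genuine
datum `ρ₀` (if one exists), on which the dropped-H3 conclusion is an a-priori bound `twinCorr_k = o(ρ^{-k})` implied by
TT itself. H3's real job is inside TwinTransfer (it pins `A = id`), not in TT. -/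

/-- `|⟨box monomial⟩| ≤ 1` in every free twin box. [folklore] -/
theorem abs_twinBoxC_le_one (J : ℝ) (L k : ℕ) (z : Fin k → Site 3) : |twinBoxC J L k z| ≤ 1 := by
  unfold twinBoxC
  refine (PairIsing.abs_gibbsAvg_le _ _).trans ?_
  refine (PairIsing.gibbsAvg_mono _ (g := fun _ => (1:ℝ)) fun s => ?_).trans (PairIsing.gibbsAvg_const _ 1).le
  rw [Finset.abs_prod]
  refine Finset.prod_le_one (fun _ _ => abs_nonneg _) fun i _ => ?_
  split_ifs
  · simp [spinAt, abs_le]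
    rcases Int.units_eq_one_or (s ⟨z i, by assumption⟩) with h | h <;> simp [h]
  · simp

/-- `|twinLat J k z| ≤ 1`: the sup over boxes of numbers in `[-1, 1]`. [folklore] -/
theorem abs_twinLatC_le_one (J : ℝ) (k : ℕ) (z : Fin k → Site 3) : |twinLatC J k z| ≤ 1 := by
  rw [twinLatC_eq_iSup, abs_le]
  have hb : BddAbove (Set.range fun L => twinBoxC J L k z) :=
    ⟨1, by rintro _ ⟨L, rfl⟩; exact (abs_le.mp (abs_twinBoxC_le_one J L k z)).2⟩
  exact ⟨le_ciSup_of_le hb 0 (abs_le.mp (abs_twinBoxC_le_one J 0 k z)).1,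
    ciSup_le fun L => (abs_le.mp (abs_twinBoxC_le_one J L k z)).2⟩

/-- The empty monomial: `twinLat J 0 z = 1`. [folklore] -/
theorem twinLatC_zero (J : ℝ) (z : Fin 0 → Site 3) : twinLatC J 0 z = 1 := by
  rw [twinLatC_eq_iSup]
  have : (fun L => twinBoxC J L 0 z) = fun _ => 1 := by
    funext L
    unfold twinBoxC
    simp only [Finset.univ_eq_empty, Finset.prod_empty]
    exact PairIsing.gibbsAvg_const _ 1
  rw [this, ciSup_const]

/-- The critical `0`-point correlator is `1`. [folklore] -/
theorem criticalCorr_three_zero (x : Fin 0 → Site 3) : criticalCorr 3 0 x = 1 := by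
  have : spinMonomial x = fun _ => (1:ℝ) := by
    funext s; simp [spinMonomial]
  rw [criticalCorr, this]
  exact plusExpect_one (d := 3) _ _

/-- `exp(-1/δ) → 0` as `δ → 0⁺`. [folklore] -/
theorem tendsto_exp_neg_inv_nhdsGT_zero :
    Tendsto (fun δ : ℝ => Real.exp (-δ⁻¹)) (𝓝[>] (0:ℝ)) (𝓝 0) :=
  Real.tendsto_exp_atBot.comp (tendsto_neg_atTop_atBot.comp tendsto_inv_nhdsGT_zero)

/-- A uniformly small sequence of functions tends to `0` locally uniformly: if `|F δ x| ≤ g δ` on `s` and `g → 0`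
along `p`, then `F → 0` locally uniformly on `s`. [folklore] -/
theorem tendstoLocallyUniformlyOn_zero_of_abs_le {X : Type*} [TopologicalSpace X] {p : Filter ℝ}
    {F : ℝ → X → ℝ} {g : ℝ → ℝ} {s : Set X} (hF : ∀ᶠ δ in p, ∀ x ∈ s, |F δ x| ≤ g δ)
    (hg : Tendsto g p (𝓝 0)) : TendstoLocallyUniformlyOn F (fun _ => 0) p s := by
  refine TendstoUniformlyOn.tendstoLocallyUniformlyOn ?_
  rw [Metric.tendstoUniformlyOn_iff]
  intro ε hε
  filter_upwards [hF, (Metric.tendsto_nhds.mp hg) ε hε] with δ hδ hgδ x hx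
  rw [Real.dist_eq, zero_sub, abs_neg]
  rw [Real.dist_eq, sub_zero] at hgδ
  exact (hδ x hx).trans_lt ((le_abs_self _).trans_lt hgδ)

/-- **The degenerate datum is a pointwise scaling limit** (H1 ∧ H2 ∧ ¬H3). [folklore] -/
theorem hasLimit_degenerate :
    HasPointwiseScalingLimit (criticalCorr 3) (fun δ => Real.exp (-δ⁻¹)) (fun n _ => if n = 0 then 1 else 0) := by
  intro n
  rcases Nat.eq_zero_or_pos n with rfl | hn
  · -- `n = 0`: the constant `1`
    simp only [if_true]
    refine TendstoUniformlyOn.tendstoLocallyUniformlyOn ?_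
    rw [Metric.tendstoUniformlyOn_iff]
    intro ε hε
    refine Filter.Eventually.of_forall fun δ x _ => ?_
    rw [rescaledCorrelator_apply, pow_zero, one_mul, criticalCorr_three_zero, dist_self]
    exact hε
  · simp only [if_neg hn.ne']
    refine tendstoLocallyUniformlyOn_zero_of_abs_le (g := fun δ => Real.exp (-δ⁻¹)) ?_ tendsto_exp_neg_inv_nhdsGT_zero
    refine eventually_nhdsWithin_of_forall fun δ hδ x _ => ?_
    rw [rescaledCorrelator_apply, abs_mul, abs_pow, abs_of_pos (Real.exp_pos _)]
    calc Real.exp (-δ⁻¹) ^ n * |criticalCorr 3 n fun i => latticeApprox δ (x i)|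
        ≤ Real.exp (-δ⁻¹) ^ n * 1 :=
          mul_le_mul_of_nonneg_left (abs_criticalCorr_le_one le_rfl n _) (pow_nonneg (Real.exp_pos _).le n)
      _ ≤ Real.exp (-δ⁻¹) := by
          rw [mul_one]
          refine pow_le_of_le_one (Real.exp_pos _).le ?_ hn.ne'
          rw [Real.exp_le_one_iff, neg_nonpos]
          exact (inv_pos.mpr hδ).le

/-- The degenerate datum is positive on `(0,1]` (H1) but violates H3. [folklore] -/
theorem degenerate_H1_not_H3 :
    (∀ δ ∈ Set.Ioc (0:ℝ) 1, 0 < Real.exp (-δ⁻¹)) ∧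
      ¬ IsNondegenerateTwoPoint (d := 3) (fun n _ => if n = 0 then (1:ℝ) else 0) := by
  refine ⟨fun δ _ => Real.exp_pos _, fun h => ?_⟩
  have := h ![-nrmC, nrmC] (by
    rw [mem_nonCoincident]
    refine injective_fin_two ?_
    simp only [Matrix.cons_val_zero, Matrix.cons_val_one]
    intro h'
    have := congrArg (fun v : E => v 0) h'
    simp only [neg_nrmC_apply, nrmC_apply] at this
    norm_num at this)
  simp at this

/-- **The degenerate datum satisfies the CONCLUSION of TT at every seam coupling, with `A = id`.** [folklore] -/
theorem conclusion_degenerate (J : ℝ) :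
    ∃ A : E →ₗ[ℝ] E, (∀ v, v 0 + v 1 + v 2 = 0 → A v = v) ∧ (∀ v, 0 < v 0 + v 1 + v 2 → 0 < A v 0 + A v 1 + A v 2) ∧
        ∀ k : ℕ, TendstoLocallyUniformlyOn (fun δ w => Real.exp (-δ⁻¹) ^ k * twinCorrC J δ k w)
          (fun w => (fun n (_ : Fin n → E) => if n = 0 then (1:ℝ) else 0) k
            (fun i => if w i 0 + w i 1 + w i 2 ≤ 0 then w i else LinearMap.id (R := ℝ) (w i))) (𝓝[>] (0:ℝ))
          (NonCoincident 3 k ∩ {w | ∀ i, w i 0 + w i 1 + w i 2 ≠ 0}) := by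
  refine ⟨LinearMap.id, fun v _ => rfl, fun v hv => hv, fun k => ?_⟩
  rcases Nat.eq_zero_or_pos k with rfl | hk
  · simp only [if_true]
    refine TendstoUniformlyOn.tendstoLocallyUniformlyOn ?_
    rw [Metric.tendstoUniformlyOn_iff]
    intro ε hε
    refine Filter.Eventually.of_forall fun δ w _ => ?_
    have : twinCorrC J δ 0 w = 1 := twinLatC_zero J _
    rw [pow_zero, one_mul, this, dist_self]
    exact hε
  · simp only [if_neg hk.ne']
    refine tendstoLocallyUniformlyOn_zero_of_abs_le (g := fun δ => Real.exp (-δ⁻¹)) ?_ tendsto_exp_neg_inv_nhdsGT_zero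
    refine eventually_nhdsWithin_of_forall fun δ hδ w _ => ?_
    rw [abs_mul, abs_pow, abs_of_pos (Real.exp_pos _)]
    have hle : |twinCorrC J δ k w| ≤ 1 := abs_twinLatC_le_one J k _
    calc Real.exp (-δ⁻¹) ^ k * |twinCorrC J δ k w| ≤ Real.exp (-δ⁻¹) ^ k * 1 :=
          mul_le_mul_of_nonneg_left hle (pow_nonneg (Real.exp_pos _).le k)
      _ ≤ Real.exp (-δ⁻¹) := by
          rw [mul_one]
          refine pow_le_of_le_one (Real.exp_pos _).le ?_ hk.ne'
          rw [Real.exp_le_one_iff, neg_nonpos]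
          exact (inv_pos.mpr hδ).le

/-! ### §3c Why the OTHER natural threshold mutation is not cheap (correction to crux-attack r1 §6)

r1 proposed "`_false_without_threshold`: at a coupling with plane LRO, `ρ(δ)² · twin₂ ≥ ρ² m → ∞`". The bound
`twin₂ ≥ m` holds for PLANE-LAYER sites only (`LRO` quantifies over `c` with `h c = 0`), and the crux never reads a
plane-layer site: for `hR v < 0` the copy-1 site `⌊v/δ⌋` has `h ≤ -1`, for `hR v > 0` the copy-2 site has `h ≥ 1`
(floor sums; `height_siteC_*` above are the instances used here). For two continuum points at macroscopic depths
`t, t'` the ordered-plane ("extraordinary") correlator is `≈ m(t/δ) m(t'/δ) + connected`, with the magnetisation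
profile `m(R) ≍ R^{-Δ_σ}` — so `ρ² twin₂ = O(1)`, NOT `→ ∞`; refuting the conclusion at an LRO coupling requires the
two-sided profile bound `c R^{-Δ} ≤ m(R)` with the SAME `Δ` as the bulk decay `ρ(δ) ≍ δ^{-Δ}` (then
`lim inf ρ² twin₂(w₁,w₂) ≥ c² (t t')^{-Δ} m_∞²` uniformly in the lateral separation, contradicting
`S₂(w₁,w₂) → 0` as `|w₁ - w₂| → ∞` for the nice `S` of the tree). GKS chains give only
`⟨σ_xσ_y⟩ ≥ ⟨σ_xσ_c⟩ m ⟨σ_{c'}σ_y⟩` and the point-to-plane factor has no polynomial lower bound in tree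
(`m(R) ≥ G_bulk(R) ≍ R^{-2Δ}` from the plus-b.c. comparison is too weak by `R^{-Δ}`). Recorded as the sorry'd
near-miss `conclusion_false_of_LRO_of_profileBound` in §5 with the missing input made a hypothesis. -/

/-! ## §4 Line `replica-mirror` (v2 skeleton `Lines/replica_mirror.lean`, 7 stubs) — stub-by-stub verdicts

No stub is broken; none is refutable in this generation. Details (signatures read from `Sig.*`, 2026-08-17T14Z):

* S1 `stub_twinBoxMonotone` — TRUE, LANDED (`Theorems/ReflectionTwinTwinTransparencyTwinBoxMonotone.lean`).
* S2 `stub_seamLebowitzIncrement` — TRUE (finite volume; `d/dJ ⟨f⟩ = β_c Σ_{unordered plane bonds} Cov(f, σ_uσ_v)`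
  because the ordered-pair matrix carries `β_c/2` twice; Lebowitz pair form; `Σ_{bonds∋w} ≤ 6` per slab site).
  Remark for the prover: the registered constant `12 β_c` has a factor-2 slack — `6 β_c (J₂-J₁) M²` already holds;
  harmless (the stub is an upper bound). `M ≥ 1` automatically (`b = a` term), `L = 0` trivial.
* S3 `stub_thresholdNotCut` — TRUE given S1, S2 (finite-volume Riccati comparison `g(J') ≤ g(J*) + C (J'-J*) g(J')²`,
  continuity of finite-volume sums in `J'`, uniform in `L` through `M* = slabChi J* < ⊤`; then `slabChi J' < ⊤` for
  `J' < J* + 1/(4 C M*)` contradicts `LRO J'`, which forces `Σ_c ⟨σ_0σ_c⟩ = ⊤`). Uses `∀ J' > J*, LRO J'` — the clause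
  §3a shows to be load-bearing — exactly once.
* S4 `stub_replicaLower` — TRUE: with all points below, `replicaFold` is the free-box bulk correlator (the conditional
  factor is `E[1 | ·] = 1`), `limsup_L` = `lim_L` (GKS II), and free = plus at `β_c(3)` is the tree theorem
  `criticalCorr_wellDefined_holds` (ADS2015 continuity ⇒ unique critical state); then H2 transfers verbatim (same
  lattice function). NB the stub carries neither `ρ > 0` nor `S₂ > 0` — not needed, since at every `δ` the two
  lattice functions COINCIDE. Shield: none needed (it is an identity plus H2).
* S5 `stub_replicaMirrorUpper` — OPEN; shielded by the datum existence (H1–H3) exactly like the crux. Content = in-plane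
  half-turn covariance of the half-crystal's conditional response (`m_{ιz}(Rσ_C) ≈ m_z(σ_C)` in `ν`-correlation); its
  all-upper instance is θ-invariance of `S` (tree theorem for every datum, skeleton §4 `theta_invariance_of_limit`);
  exact for the lattice GFF (harmonic extension is a quadratic form). No lattice identity contradicts it (the twin's
  plane law differs from the plane-defect law by the `R`-odd cocycle `e^{2W_odd}`, DETECTED at 6.6σ in the ideator's
  MC §2.3 — consistent with S5, which is an asymptotic statement).
* S6 `stub_planeCriticalTwinIsReplica` — OPEN, hardest; shielded by H1–H3 AND by `∃ J, PlaneCritical J`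
  (`0 < J ∧ slabChi J = ⊤ ∧ ¬LRO J`). The `J = 0` witness of §3a is excluded by `0 < J`; independently `slabChi 0 < ⊤`
  is expected (decoupled slab = two ordinary surfaces + free spins, `2Δ̂_ord ≈ 2.53 > 2` ⇒ summable) but is itself not
  provable in tree — so within `PlaneCritical` the clause `0 < J` is the cheap guard and `slabChi = ⊤` the informative
  one. Physically `PlaneCritical J ⇔ J = J*` (χ_plane finite in ord⊕ord since `γ₁₁^{ord} < 0`; LRO above): the
  local-in-`J` form loses nothing.
* S7 `stub_twinEquicontinuity` — OPEN; shielded by H1–H3 and `PlaneCritical`; NECESSARY for the crux (skeleton §5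
  `asympEquicontinuousOn_of_tendstoLocallyUniformlyOn`), so unbreakable without breaking the crux.
* Joint sufficiency `TwinTransparency_of` is kernel-checked (SKELVET PASS); no gap smuggled: S7 supplies exactly the
  local uniformity that S4/S5/S6 (pointwise) drop, and `A := id`.

Posted: no `stub-false` / `stub-misstated` note is warranted this cycle. -/

/-! ## §5 Near-misses (sorry allowed ONLY here) · presearch · numerics

PRESEARCH (2026-08-17, both corpora): "non-trivial ℤ₂×θ-symmetric codimension-one conformal interface of the 3D Ising
class with exactly one relevant even direction" → NONE in print. [corpus: paper:arxiv-2301.05728 (KrishnanMetlitski2023)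
p.3: "we have found a special fixed point for all N that simply corresponds to the model with no defect … All other
O(N) singlet defect perturbations are irrelevant (the next lowest one is expected to be ∂_zε, which is odd under the
reflection symmetry z → −z)"; p.9: "the special fixed point corresponds to a trivial interface"; p.3: for c > 0 flow to
the ordinary fixed point = two decoupled ordinary halves, leading perturbation φ̂¹φ̂² irrelevant since Δ̂_ord > 1].
[corpus: paper:arxiv-1502.07217 (GLMR2015) §4: the only bootstrapped 3D-Ising interface is the free|Ising RG domain wall
— a different object]. Queries: `lit search --hybrid "conformal interface three-dimensional Ising plane defect fixed
point relevant"` (12 textbook hits, none on interfaces); arXiv ×7 ("defect conformal field theory interface Ising" →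
KM2023-type and 2D/tricritical interfaces only; "plane defect O(N) model" → KM2023, ParisenToldin–Krishnan–Metlitski
2024 extraordinary-log FSS; "conformal boundary conditions Ising fuzzy sphere" → Dedushenko 2024 BCFT, Feng–Wang 2026
surface CFT — boundaries, not symmetric interfaces); `lit galaxy search "conformal interface|plane defect|defect plane"
--star all` (36 rows, all noise); openalex/s2 HTTP 429 (search-degraded for those two sources only). So the crux's
kill criterion (ii) has no printed trigger; its criterion (i) is numerically disfavoured (below).

NUMERICS supporting the crux (ideator `planner-cruxidea-…-16905-1-0`, crux `NOTES.md`, kit j024992/3/4, j025040,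
j025136, j025249; SW cluster MC of the route's exact typing, L = 16…48): `J*_TW = 1.000 ± 0.003`; every pairwise
transparency coupling `1.000 ± 0.002`; cross/bulk amplitude `κ = 1.00 ± 0.02` at separations 3.5–13.9; two-sided
relevant flow at `J = 0.95 / 1.05`; plane observables of `TW(1.00)` = bulk-layer values within 0.2σ at L = 36, 48.
Nothing for a disprover to contradict at accessible scales; the one lattice-scale asymmetry found (R-odd plane
four-point function, 2.7 %, 6.6σ) is ALLOWED by TT (lattice-scale, `p3m1` plane symmetry) and only its persistence
under dilation would strain TT — an O(10²) core-hour measurement with expected null result (R-odd sector irrelevant,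
dimension gap ≳ 3), not run this cycle. -/

/-- **Near-miss input (conjectural, isolated as a hypothesis).** The two-sided extraordinary-profile bound that §3c
identifies as the missing ingredient, stated for the twin at a coupling `J`: the renormalised twin two-point function
of two points at depth `1` below the plane stays bounded BELOW by a positive constant independent of their lateral
separation `a` (in-plane direction `e₀ - e₁`). Physically standard at an LRO coupling (ordered plane ⇒
`⟨σ_xσ_y⟩ ≈ m(x)m(y)`, `m(R) ≍ R^{-Δ_σ}`); no rigorous source (the profile exponent at the extraordinary transition
equals the bulk `Δ_σ` only conjecturally). [cite: KrishnanMetlitski2023, §1] -/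
def OrderedPlaneProfileBound (J : ℝ) (ρ : ℝ → ℝ) : Prop :=
  ∃ c : ℝ, 0 < c ∧ ∀ a : ℝ, ∀ᶠ δ in 𝓝[>] (0:ℝ),
    c ≤ ρ δ ^ 2 * twinCorrC J δ 2 ![-nrmC, -nrmC + a • (EuclideanSpace.single 0 1 - EuclideanSpace.single 1 1)]

/-- **Near-miss `conclusion_false_of_LRO_of_profileBound` (NOT proved this cycle).** Granted
`OrderedPlaneProfileBound J ρ`, the conclusion of TT at `J` fails for every datum whose two-point limit tends to `0`
at large separation — which holds for EVERY datum by the tree (`twoPointKernelOfLimit_proof`: `S₂(0,v) = C‖v‖^{-2Δ'}`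
for nice data; every datum is nice on `NonCoincident` by `MoebiusLimitExistsNegative.*`). Both points of the witness
pair lie BELOW the plane, so `A` is never applied and only `S₂(-n, -n + a u) → 0` (`a → ∞`) is needed; threading the
normalisation lemmas is routine and left undone because the result is a negative-side CONVENIENCE, not a refutation
(its hypothesis — an LRO coupling — contradicts `IsSeamThreshold J`). Obstruction if attempted WITHOUT `hprof`: §3c. -/
theorem conclusion_false_of_LRO_of_profileBound (J : ℝ) (ρ : ℝ → ℝ) (S : CorrFamily 3)
    (hρ : ∀ δ ∈ Set.Ioc (0:ℝ) 1, 0 < ρ δ) (hlim : HasPointwiseScalingLimit (criticalCorr 3) ρ S)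
    (hnd : IsNondegenerateTwoPoint S) (hprof : OrderedPlaneProfileBound J ρ) :
    ¬ ∃ A : E →ₗ[ℝ] E, (∀ v, v 0 + v 1 + v 2 = 0 → A v = v) ∧ (∀ v, 0 < v 0 + v 1 + v 2 → 0 < A v 0 + A v 1 + A v 2) ∧
        ∀ k : ℕ, TendstoLocallyUniformlyOn (fun δ w => ρ δ ^ k * twinCorrC J δ k w)
          (fun w => S k (fun i => if w i 0 + w i 1 + w i 2 ≤ 0 then w i else A (w i))) (𝓝[>] (0:ℝ))
          (NonCoincident 3 k ∩ {w | ∀ i, w i 0 + w i 1 + w i 2 ≠ 0}) := by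
  sorry

end Summit.CriticalPhenomena.Ising3DConformalLimit.Cruxes.TwinTransparency.Disproof
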